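import Summits.QuantumFields.YangMills.Theorems.AllWindowsColdBoxBoxHighLineGaussianHypercontractivity

/-!
# T-S5.10-H (function-level form) «decorrelation of squares for certified-polynomial observables of the chart Gaussian»

Companion of ✓`…GaussianHypercontractivity` (planner ym-idea-2 g18's STEP 2 of the XL stub S5, LINE-19 ⟨stmt-QuantumFields-24004⟩/⟨24335⟩;
consumer = the LEAD's T-S5.10 «moment decorrelation»).  The chart-Gaussian inequalities of that file are restated for observables
`F : (ι → ℝ) → ℝ` that are CERTIFIED polynomial of bounded degree by the hypothesis

  `∃ Q : MvPolynomial ι ℝ, Q.totalDegree ≤ d ∧ ∀ v, F v = MvPolynomial.eval v Q`      (no definition is introduced),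

together with the closure lemmas by which a consumer discharges it in a few lines (`polyDeg_const`, `polyDeg_coord`, `polyDeg_dotProduct`,
`polyDeg_dotProduct'`, `polyDeg_mulVec`, `polyDeg_add`, `polyDeg_neg`, `polyDeg_sub` (centring!), `polyDeg_const_mul`, `polyDeg_mul`, `polyDeg_pow`,
`polyDeg_sum`, `polyDeg_prod`, `polyDeg_mono`, `polyDeg_congr`):

* **`integral_pow_mul_exp_quadForm_le_of_polyDeg`** — `Z^{r−1}·∫ F^{2r} e^{−β vᵀPv} ≤ (2r−1)^{rd}·(∫ F² e^{−β vᵀPv})^r`;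
* **`integral_sq_mul_sq_mul_exp_quadForm_le_of_polyDeg`** — `Z·∫ F²G² e ≤ 3^{p+q}·(∫ F² e)·(∫ G² e)` (`deg F ≤ p`, `deg G ≤ q`);
* **`expect_sq_mul_sq_le_of_polyDeg`** — the normalised form `E₀[F²G²] ≤ 3^{p+q}·E₀[F²]·E₀[G²]`, `E₀[X] = Z⁻¹∫ X e^{−β vᵀPv}`;
* the `(∫ e)`-forms asked for by the consumer (LEAD g77): **`integral_pow_four_mul_integral_exp_le`** `(∫ Q⁴ e)·(∫ e) ≤ 9^d·(∫ Q² e)²` and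
  **`integral_sq_mul_sq_mul_integral_exp_le`** `(∫ A²B² e)·(∫ e) ≤ 3^{p+q}·(∫ A² e)·(∫ B² e)` (+ `…_of_polyDeg` versions);
* `integral_centredSq_sq_mul_cubic_sq_le` — worked T-S5.10-shaped instance: `F = (a·v)² − c` (centred square of a leg, degree 2),
  `G = (b₁·v)(b₂·v)(b₃·v)` (cubic in three legs), constant `3⁵ = 243`.

Here `Z = √(π/β)^{|ι|}/√(det P)`, `P : Matrix ι ι ℝ` positive definite, `β > 0` (letters of ✓`GaussianChartWickFintype`).  No definitions, no
named facts.  HONEST LABEL: helper lemmas in service of STEP 2 of the XL stub S5 of a critic-PASSed DRAFT line; T-S5.10, S5, U5,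
⟨stmt-QuantumFields-24004⟩ ⟨24335⟩ ⟨24336⟩ remain OPEN; route AllWindowsColdBox is DRAFT; **the Yang–Mills mass gap is NOT proved by this file;
no summit is proved by a line.**  Seat ym-line-sfw-p2-w5 g22 (EXTRA WIDTH seat w5, cell ym-idea-1).
-/

set_option autoImplicit false

noncomputable section

open MeasureTheory ProbabilityTheory Matrix Finset
open scoped NNReal ENNReal
open Literature.Probability.Distributions

namespace Summit.QuantumFields.YangMills.Theorems.AllWindowsColdBoxBoxHighLine

namespace Hypercontractivity

variable {ι : Type*} [Fintype ι]
/-! ## Function-level form: observables CERTIFIED polynomial of bounded degree (no definition — an `∃` hypothesis)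

The consumer (T-S5.10: `A = c̃₀^{(2)}` a quadratic, `B = V₃` a cubic in the chart variables) proves
`∃ Q : MvPolynomial ι ℝ, Q.totalDegree ≤ d ∧ ∀ v, F v = MvPolynomial.eval v Q` with the closure lemmas below. -/

section PolyAPI

omit [Fintype ι]

/-- Constants are polynomial of every degree bound. -/
theorem polyDeg_const (c : ℝ) (d : ℕ) :
    ∃ Q : MvPolynomial ι ℝ, Q.totalDegree ≤ d ∧ ∀ v : ι → ℝ, c = MvPolynomial.eval v Q :=
  ⟨MvPolynomial.C c, by rw [MvPolynomial.totalDegree_C]; exact Nat.zero_le _, fun _ => (MvPolynomial.eval_C c).symm⟩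

/-- A coordinate is polynomial of degree `≤ 1`. -/
theorem polyDeg_coord (i : ι) {d : ℕ} (hd : 1 ≤ d) :
    ∃ Q : MvPolynomial ι ℝ, Q.totalDegree ≤ d ∧ ∀ v : ι → ℝ, v i = MvPolynomial.eval v Q :=
  ⟨MvPolynomial.X i, (MvPolynomial.totalDegree_X (R := ℝ) i).le.trans hd, fun _ => (MvPolynomial.eval_X i).symm⟩

/-- Raising the degree bound. -/
theorem polyDeg_mono {F : (ι → ℝ) → ℝ} {d d' : ℕ} (hdd : d ≤ d')
    (hF : ∃ Q : MvPolynomial ι ℝ, Q.totalDegree ≤ d ∧ ∀ v, F v = MvPolynomial.eval v Q) :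
    ∃ Q : MvPolynomial ι ℝ, Q.totalDegree ≤ d' ∧ ∀ v, F v = MvPolynomial.eval v Q := by
  obtain ⟨Q, hQ, hFQ⟩ := hF
  exact ⟨Q, hQ.trans hdd, hFQ⟩

/-- Changing the function pointwise. -/
theorem polyDeg_congr {F G : (ι → ℝ) → ℝ} {d : ℕ} (hFG : ∀ v, G v = F v)
    (hF : ∃ Q : MvPolynomial ι ℝ, Q.totalDegree ≤ d ∧ ∀ v, F v = MvPolynomial.eval v Q) :
    ∃ Q : MvPolynomial ι ℝ, Q.totalDegree ≤ d ∧ ∀ v, G v = MvPolynomial.eval v Q := by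
  obtain ⟨Q, hQ, hFQ⟩ := hF
  exact ⟨Q, hQ, fun v => (hFG v).trans (hFQ v)⟩

/-- Sums. -/
theorem polyDeg_add {F G : (ι → ℝ) → ℝ} {d : ℕ}
    (hF : ∃ Q : MvPolynomial ι ℝ, Q.totalDegree ≤ d ∧ ∀ v, F v = MvPolynomial.eval v Q)
    (hG : ∃ Q : MvPolynomial ι ℝ, Q.totalDegree ≤ d ∧ ∀ v, G v = MvPolynomial.eval v Q) :
    ∃ Q : MvPolynomial ι ℝ, Q.totalDegree ≤ d ∧ ∀ v, F v + G v = MvPolynomial.eval v Q := by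
  obtain ⟨A, hA, hFA⟩ := hF
  obtain ⟨B, hB, hGB⟩ := hG
  refine ⟨A + B, (MvPolynomial.totalDegree_add A B).trans (max_le hA hB), fun v => ?_⟩
  rw [map_add, hFA, hGB]

/-- Negation. -/
theorem polyDeg_neg {F : (ι → ℝ) → ℝ} {d : ℕ}
    (hF : ∃ Q : MvPolynomial ι ℝ, Q.totalDegree ≤ d ∧ ∀ v, F v = MvPolynomial.eval v Q) :
    ∃ Q : MvPolynomial ι ℝ, Q.totalDegree ≤ d ∧ ∀ v, -F v = MvPolynomial.eval v Q := by
  obtain ⟨A, hA, hFA⟩ := hF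
  refine ⟨-A, by rwa [MvPolynomial.totalDegree_neg], fun v => ?_⟩
  rw [map_neg, hFA]

/-- Differences (e.g. CENTRING `F − E₀ F` keeps the degree). -/
theorem polyDeg_sub {F G : (ι → ℝ) → ℝ} {d : ℕ}
    (hF : ∃ Q : MvPolynomial ι ℝ, Q.totalDegree ≤ d ∧ ∀ v, F v = MvPolynomial.eval v Q)
    (hG : ∃ Q : MvPolynomial ι ℝ, Q.totalDegree ≤ d ∧ ∀ v, G v = MvPolynomial.eval v Q) :
    ∃ Q : MvPolynomial ι ℝ, Q.totalDegree ≤ d ∧ ∀ v, F v - G v = MvPolynomial.eval v Q := by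
  obtain ⟨A, hA, hFA⟩ := hF
  obtain ⟨B, hB, hGB⟩ := hG
  refine ⟨A - B, (MvPolynomial.totalDegree_sub A B).trans (max_le hA hB), fun v => ?_⟩
  rw [map_sub, hFA, hGB]

/-- Scalar multiples. -/
theorem polyDeg_const_mul (c : ℝ) {F : (ι → ℝ) → ℝ} {d : ℕ}
    (hF : ∃ Q : MvPolynomial ι ℝ, Q.totalDegree ≤ d ∧ ∀ v, F v = MvPolynomial.eval v Q) :
    ∃ Q : MvPolynomial ι ℝ, Q.totalDegree ≤ d ∧ ∀ v, c * F v = MvPolynomial.eval v Q := by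
  obtain ⟨A, hA, hFA⟩ := hF
  refine ⟨MvPolynomial.C c * A, (MvPolynomial.totalDegree_mul _ _).trans ?_, fun v => ?_⟩
  · rw [MvPolynomial.totalDegree_C, zero_add]; exact hA
  · rw [map_mul, MvPolynomial.eval_C, hFA]

/-- Products: degrees add. -/
theorem polyDeg_mul {F G : (ι → ℝ) → ℝ} {p q : ℕ}
    (hF : ∃ Q : MvPolynomial ι ℝ, Q.totalDegree ≤ p ∧ ∀ v, F v = MvPolynomial.eval v Q)
    (hG : ∃ Q : MvPolynomial ι ℝ, Q.totalDegree ≤ q ∧ ∀ v, G v = MvPolynomial.eval v Q) :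
    ∃ Q : MvPolynomial ι ℝ, Q.totalDegree ≤ p + q ∧ ∀ v, F v * G v = MvPolynomial.eval v Q := by
  obtain ⟨A, hA, hFA⟩ := hF
  obtain ⟨B, hB, hGB⟩ := hG
  refine ⟨A * B, (MvPolynomial.totalDegree_mul A B).trans (Nat.add_le_add hA hB), fun v => ?_⟩
  rw [map_mul, hFA, hGB]

/-- Powers: `deg F^k ≤ k · deg F`. -/
theorem polyDeg_pow {F : (ι → ℝ) → ℝ} {p : ℕ}
    (hF : ∃ Q : MvPolynomial ι ℝ, Q.totalDegree ≤ p ∧ ∀ v, F v = MvPolynomial.eval v Q) (k : ℕ) :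
    ∃ Q : MvPolynomial ι ℝ, Q.totalDegree ≤ k * p ∧ ∀ v, F v ^ k = MvPolynomial.eval v Q := by
  obtain ⟨A, hA, hFA⟩ := hF
  refine ⟨A ^ k, (MvPolynomial.totalDegree_pow A k).trans (Nat.mul_le_mul_left k hA), fun v => ?_⟩
  rw [map_pow, hFA]

/-- Finite sums with a uniform degree bound. -/
theorem polyDeg_sum {κ : Type*} (s : Finset κ) {F : κ → (ι → ℝ) → ℝ} {d : ℕ}
    (hF : ∀ k ∈ s, ∃ Q : MvPolynomial ι ℝ, Q.totalDegree ≤ d ∧ ∀ v, F k v = MvPolynomial.eval v Q) :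
    ∃ Q : MvPolynomial ι ℝ, Q.totalDegree ≤ d ∧ ∀ v, ∑ k ∈ s, F k v = MvPolynomial.eval v Q := by
  classical
  choose! Q hQ hFQ using hF
  refine ⟨∑ k ∈ s, Q k, (MvPolynomial.totalDegree_finsetSum s Q).trans (Finset.sup_le fun k hk => hQ k hk),
    fun v => ?_⟩
  rw [map_sum]
  exact Finset.sum_congr rfl fun k hk => hFQ k hk v

/-- Finite products: degrees add up. -/
theorem polyDeg_prod {κ : Type*} (s : Finset κ) {F : κ → (ι → ℝ) → ℝ} {d : κ → ℕ}
    (hF : ∀ k ∈ s, ∃ Q : MvPolynomial ι ℝ, Q.totalDegree ≤ d k ∧ ∀ v, F k v = MvPolynomial.eval v Q) :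
    ∃ Q : MvPolynomial ι ℝ, Q.totalDegree ≤ ∑ k ∈ s, d k ∧ ∀ v, ∏ k ∈ s, F k v = MvPolynomial.eval v Q := by
  classical
  choose! Q hQ hFQ using hF
  refine ⟨∏ k ∈ s, Q k, (MvPolynomial.totalDegree_finsetProd s Q).trans (Finset.sum_le_sum fun k hk => hQ k hk),
    fun v => ?_⟩
  rw [map_prod]
  exact Finset.prod_congr rfl fun k hk => hFQ k hk v

variable [Fintype ι]

/-- A linear form `a ⬝ᵥ v` is polynomial of degree `≤ 1` (the legs of ✓`GaussianChartWick`). -/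
theorem polyDeg_dotProduct (a : ι → ℝ) {d : ℕ} (hd : 1 ≤ d) :
    ∃ Q : MvPolynomial ι ℝ, Q.totalDegree ≤ d ∧ ∀ v : ι → ℝ, a ⬝ᵥ v = MvPolynomial.eval v Q := by
  refine polyDeg_sum (d := d) Finset.univ (F := fun i v => a i * v i) fun i _ => ?_
  exact polyDeg_const_mul (a i) (polyDeg_coord i hd)

/-- A linear form `v ⬝ᵥ a` is polynomial of degree `≤ 1`. -/
theorem polyDeg_dotProduct' (a : ι → ℝ) {d : ℕ} (hd : 1 ≤ d) :
    ∃ Q : MvPolynomial ι ℝ, Q.totalDegree ≤ d ∧ ∀ v : ι → ℝ, v ⬝ᵥ a = MvPolynomial.eval v Q :=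
  polyDeg_congr (fun v => dotProduct_comm v a) (polyDeg_dotProduct a hd)

/-- The image under a matrix, `(L *ᵥ v) k`, is polynomial of degree `≤ 1`. -/
theorem polyDeg_mulVec {κ : Type*} (L : Matrix κ ι ℝ) (k : κ) {d : ℕ} (hd : 1 ≤ d) :
    ∃ Q : MvPolynomial ι ℝ, Q.totalDegree ≤ d ∧ ∀ v : ι → ℝ, (L *ᵥ v) k = MvPolynomial.eval v Q :=
  polyDeg_dotProduct (fun i => L k i) hd

end PolyAPI

/-! ## The two inequalities for certified-polynomial observables -/

section Observables

variable [DecidableEq ι]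

/-- **HYPERCONTRACTIVITY FOR A CERTIFIED-POLYNOMIAL OBSERVABLE**: if `F` is polynomial of degree `≤ d` in the chart variables,
`Z^{r−1} · ∫ F^{2r} e^{−β vᵀPv} ≤ (2r−1)^{rd} · (∫ F² e^{−β vᵀPv})^r` (`Z = √(π/β)^{|ι|}/√(det P)`, `P` positive definite, `β > 0`, `r ≥ 1`). -/
theorem integral_pow_mul_exp_quadForm_le_of_polyDeg (P : Matrix ι ι ℝ) (hP : P.PosDef) {β : ℝ} (hβ : 0 < β)
    {F : (ι → ℝ) → ℝ} {d : ℕ} (hF : ∃ Q : MvPolynomial ι ℝ, Q.totalDegree ≤ d ∧ ∀ v, F v = MvPolynomial.eval v Q)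
    (r : ℕ) (hr : 1 ≤ r) :
    (Real.sqrt (Real.pi / β) ^ Fintype.card ι / Real.sqrt P.det) ^ (r - 1) *
        ∫ v : ι → ℝ, F v ^ (2 * r) * Real.exp (-(β * (v ⬝ᵥ P *ᵥ v))) ≤
      (2 * r - 1 : ℝ) ^ (r * d) * (∫ v : ι → ℝ, F v ^ 2 * Real.exp (-(β * (v ⬝ᵥ P *ᵥ v)))) ^ r := by
  obtain ⟨Q, hQ, hFQ⟩ := hF
  simp only [hFQ]
  exact integral_pow_mul_exp_quadForm_le' P hP hβ d Q hQ r hr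

/-- **DECORRELATION OF SQUARES FOR CERTIFIED-POLYNOMIAL OBSERVABLES** (T-S5.10 shape: `F = c̃₀^{(2)}` of degree `≤ 2`, `G = V₃` of
degree `≤ 3` gives the constant `3⁵ = 243` and NO logarithm):
`Z · ∫ F² G² e^{−β vᵀPv} dv ≤ 3^{p+q} · (∫ F² e^{−β vᵀPv} dv) · (∫ G² e^{−β vᵀPv} dv)`. -/
theorem integral_sq_mul_sq_mul_exp_quadForm_le_of_polyDeg (P : Matrix ι ι ℝ) (hP : P.PosDef) {β : ℝ} (hβ : 0 < β)
    {F G : (ι → ℝ) → ℝ} {p q : ℕ}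
    (hF : ∃ Q : MvPolynomial ι ℝ, Q.totalDegree ≤ p ∧ ∀ v, F v = MvPolynomial.eval v Q)
    (hG : ∃ Q : MvPolynomial ι ℝ, Q.totalDegree ≤ q ∧ ∀ v, G v = MvPolynomial.eval v Q) :
    Real.sqrt (Real.pi / β) ^ Fintype.card ι / Real.sqrt P.det *
        ∫ v : ι → ℝ, F v ^ 2 * G v ^ 2 * Real.exp (-(β * (v ⬝ᵥ P *ᵥ v))) ≤
      (3 : ℝ) ^ (p + q) * (∫ v : ι → ℝ, F v ^ 2 * Real.exp (-(β * (v ⬝ᵥ P *ᵥ v)))) *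
        ∫ v : ι → ℝ, G v ^ 2 * Real.exp (-(β * (v ⬝ᵥ P *ᵥ v))) := by
  obtain ⟨A, hA, hFA⟩ := hF
  obtain ⟨B, hB, hGB⟩ := hG
  simp only [hFA, hGB]
  exact integral_sq_mul_sq_mul_exp_quadForm_le' P hP hβ A B hA hB

/-- **The normalised form** `E₀[F²G²] ≤ 3^{p+q} E₀[F²] E₀[G²]` with `E₀[X] = Z⁻¹ ∫ X e^{−β vᵀPv} dv`, `Z = √(π/β)^{|ι|}/√(det P)`. -/
theorem expect_sq_mul_sq_le_of_polyDeg (P : Matrix ι ι ℝ) (hP : P.PosDef) {β : ℝ} (hβ : 0 < β)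
    {F G : (ι → ℝ) → ℝ} {p q : ℕ}
    (hF : ∃ Q : MvPolynomial ι ℝ, Q.totalDegree ≤ p ∧ ∀ v, F v = MvPolynomial.eval v Q)
    (hG : ∃ Q : MvPolynomial ι ℝ, Q.totalDegree ≤ q ∧ ∀ v, G v = MvPolynomial.eval v Q) :
    (Real.sqrt (Real.pi / β) ^ Fintype.card ι / Real.sqrt P.det)⁻¹ *
        ∫ v : ι → ℝ, F v ^ 2 * G v ^ 2 * Real.exp (-(β * (v ⬝ᵥ P *ᵥ v))) ≤
      (3 : ℝ) ^ (p + q) *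
        ((Real.sqrt (Real.pi / β) ^ Fintype.card ι / Real.sqrt P.det)⁻¹ *
          ∫ v : ι → ℝ, F v ^ 2 * Real.exp (-(β * (v ⬝ᵥ P *ᵥ v)))) *
        ((Real.sqrt (Real.pi / β) ^ Fintype.card ι / Real.sqrt P.det)⁻¹ *
          ∫ v : ι → ℝ, G v ^ 2 * Real.exp (-(β * (v ⬝ᵥ P *ᵥ v)))) := by
  set Z : ℝ := Real.sqrt (Real.pi / β) ^ Fintype.card ι / Real.sqrt P.det with hZ
  have hZpos : 0 < Z := div_pos (pow_pos (Real.sqrt_pos.mpr (div_pos Real.pi_pos hβ)) _) (Real.sqrt_pos.mpr hP.det_pos)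
  have h := integral_sq_mul_sq_mul_exp_quadForm_le_of_polyDeg P hP hβ hF hG
  have hZ2 : 0 ≤ Z⁻¹ * Z⁻¹ := by positivity
  calc Z⁻¹ * ∫ v : ι → ℝ, F v ^ 2 * G v ^ 2 * Real.exp (-(β * (v ⬝ᵥ P *ᵥ v)))
      = Z⁻¹ * Z⁻¹ * (Z * ∫ v : ι → ℝ, F v ^ 2 * G v ^ 2 * Real.exp (-(β * (v ⬝ᵥ P *ᵥ v)))) := by
        field_simp
    _ ≤ Z⁻¹ * Z⁻¹ * ((3 : ℝ) ^ (p + q) * (∫ v : ι → ℝ, F v ^ 2 * Real.exp (-(β * (v ⬝ᵥ P *ᵥ v)))) *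
          ∫ v : ι → ℝ, G v ^ 2 * Real.exp (-(β * (v ⬝ᵥ P *ᵥ v)))) := mul_le_mul_of_nonneg_left h hZ2
    _ = (3 : ℝ) ^ (p + q) * (Z⁻¹ * ∫ v : ι → ℝ, F v ^ 2 * Real.exp (-(β * (v ⬝ᵥ P *ᵥ v)))) *
          (Z⁻¹ * ∫ v : ι → ℝ, G v ^ 2 * Real.exp (-(β * (v ⬝ᵥ P *ᵥ v)))) := by ring

/-! ### The `(∫ e)`-forms requested by the consumer (LEAD g77, T-S5.10): `Z` written as `∫ exp(−β vᵀPv) dv` -/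

/-- **`(∫ Q⁴ e)·(∫ e) ≤ 9^d·(∫ Q² e)²`** for a polynomial `Q` of total degree `≤ d` (the `(2,4)` case, `Z = ∫ e^{−β vᵀPv}` by
✓`integral_exp_neg_quadForm'`). -/
theorem integral_pow_four_mul_integral_exp_le (P : Matrix ι ι ℝ) (hP : P.PosDef) {β : ℝ} (hβ : 0 < β)
    (d : ℕ) (Q : MvPolynomial ι ℝ) (hQ : Q.totalDegree ≤ d) :
    (∫ v : ι → ℝ, MvPolynomial.eval v Q ^ 4 * Real.exp (-(β * (v ⬝ᵥ P *ᵥ v)))) *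
        ∫ v : ι → ℝ, Real.exp (-(β * (v ⬝ᵥ P *ᵥ v))) ≤
      (9 : ℝ) ^ d * (∫ v : ι → ℝ, MvPolynomial.eval v Q ^ 2 * Real.exp (-(β * (v ⬝ᵥ P *ᵥ v)))) ^ 2 := by
  have h := integral_pow_mul_exp_quadForm_le' P hP hβ d Q hQ 2 (by norm_num)
  rw [integral_exp_neg_quadForm' P hP hβ, mul_comm]
  norm_num only [show (2 : ℕ) - 1 = 1 from rfl, pow_one, show 2 * 2 = 4 from rfl] at h
  calc Real.sqrt (Real.pi / β) ^ Fintype.card ι / Real.sqrt P.det *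
        ∫ v : ι → ℝ, MvPolynomial.eval v Q ^ 4 * Real.exp (-(β * (v ⬝ᵥ P *ᵥ v)))
      ≤ (3 : ℝ) ^ (2 * d) * (∫ v : ι → ℝ, MvPolynomial.eval v Q ^ 2 * Real.exp (-(β * (v ⬝ᵥ P *ᵥ v)))) ^ 2 := h
    _ = (9 : ℝ) ^ d * (∫ v : ι → ℝ, MvPolynomial.eval v Q ^ 2 * Real.exp (-(β * (v ⬝ᵥ P *ᵥ v)))) ^ 2 := by
        rw [pow_mul]; norm_num

/-- **`(∫ A²B² e)·(∫ e) ≤ 3^{p+q}·(∫ A² e)·(∫ B² e)`** for polynomials `A`, `B` of total degree `≤ p`, `≤ q`. -/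
theorem integral_sq_mul_sq_mul_integral_exp_le (P : Matrix ι ι ℝ) (hP : P.PosDef) {β : ℝ} (hβ : 0 < β)
    {p q : ℕ} (A B : MvPolynomial ι ℝ) (hA : A.totalDegree ≤ p) (hB : B.totalDegree ≤ q) :
    (∫ v : ι → ℝ, MvPolynomial.eval v A ^ 2 * MvPolynomial.eval v B ^ 2 * Real.exp (-(β * (v ⬝ᵥ P *ᵥ v)))) *
        ∫ v : ι → ℝ, Real.exp (-(β * (v ⬝ᵥ P *ᵥ v))) ≤
      (3 : ℝ) ^ (p + q) * (∫ v : ι → ℝ, MvPolynomial.eval v A ^ 2 * Real.exp (-(β * (v ⬝ᵥ P *ᵥ v)))) *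
        ∫ v : ι → ℝ, MvPolynomial.eval v B ^ 2 * Real.exp (-(β * (v ⬝ᵥ P *ᵥ v))) := by
  rw [integral_exp_neg_quadForm' P hP hβ, mul_comm]
  exact integral_sq_mul_sq_mul_exp_quadForm_le' P hP hβ A B hA hB

/-- **`(∫ F⁴ e)·(∫ e) ≤ 9^d·(∫ F² e)²`** for an observable `F` certified polynomial of degree `≤ d`. -/
theorem integral_pow_four_mul_integral_exp_le_of_polyDeg (P : Matrix ι ι ℝ) (hP : P.PosDef) {β : ℝ} (hβ : 0 < β)
    {F : (ι → ℝ) → ℝ} {d : ℕ} (hF : ∃ Q : MvPolynomial ι ℝ, Q.totalDegree ≤ d ∧ ∀ v, F v = MvPolynomial.eval v Q) :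
    (∫ v : ι → ℝ, F v ^ 4 * Real.exp (-(β * (v ⬝ᵥ P *ᵥ v)))) * ∫ v : ι → ℝ, Real.exp (-(β * (v ⬝ᵥ P *ᵥ v))) ≤
      (9 : ℝ) ^ d * (∫ v : ι → ℝ, F v ^ 2 * Real.exp (-(β * (v ⬝ᵥ P *ᵥ v)))) ^ 2 := by
  obtain ⟨Q, hQ, hFQ⟩ := hF
  simp only [hFQ]
  exact integral_pow_four_mul_integral_exp_le P hP hβ d Q hQ

/-- **`(∫ F²G² e)·(∫ e) ≤ 3^{p+q}·(∫ F² e)·(∫ G² e)`** for observables `F`, `G` certified polynomial of degree `≤ p`, `≤ q`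
(T-S5.10: `p = 2`, `q = 3`, constant `243`). -/
theorem integral_sq_mul_sq_mul_integral_exp_le_of_polyDeg (P : Matrix ι ι ℝ) (hP : P.PosDef) {β : ℝ} (hβ : 0 < β)
    {F G : (ι → ℝ) → ℝ} {p q : ℕ}
    (hF : ∃ Q : MvPolynomial ι ℝ, Q.totalDegree ≤ p ∧ ∀ v, F v = MvPolynomial.eval v Q)
    (hG : ∃ Q : MvPolynomial ι ℝ, Q.totalDegree ≤ q ∧ ∀ v, G v = MvPolynomial.eval v Q) :
    (∫ v : ι → ℝ, F v ^ 2 * G v ^ 2 * Real.exp (-(β * (v ⬝ᵥ P *ᵥ v)))) * ∫ v : ι → ℝ, Real.exp (-(β * (v ⬝ᵥ P *ᵥ v))) ≤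
      (3 : ℝ) ^ (p + q) * (∫ v : ι → ℝ, F v ^ 2 * Real.exp (-(β * (v ⬝ᵥ P *ᵥ v)))) *
        ∫ v : ι → ℝ, G v ^ 2 * Real.exp (-(β * (v ⬝ᵥ P *ᵥ v))) := by
  obtain ⟨A, hA, hFA⟩ := hF
  obtain ⟨B, hB, hGB⟩ := hG
  simp only [hFA, hGB]
  exact integral_sq_mul_sq_mul_integral_exp_le P hP hβ A B hA hB

end Observables


/-! ## Usage (T-S5.10 shape): a centred square of a leg against a cubic in three legs -/

section Example

variable [DecidableEq ι]

/-- **Worked instance of the T-S5.10 shape**: for legs `a, b₁, b₂, b₃ : ι → ℝ` and a centring constant `c`,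
`Z·∫ ((a·v)² − c)² ((b₁·v)(b₂·v)(b₃·v))² e^{−β vᵀPv} ≤ 3⁵ · (∫ ((a·v)² − c)² e) · (∫ ((b₁·v)(b₂·v)(b₃·v))² e)`. -/
theorem integral_centredSq_sq_mul_cubic_sq_le (P : Matrix ι ι ℝ) (hP : P.PosDef) {β : ℝ} (hβ : 0 < β)
    (a b₁ b₂ b₃ : ι → ℝ) (c : ℝ) :
    Real.sqrt (Real.pi / β) ^ Fintype.card ι / Real.sqrt P.det *
        ∫ v : ι → ℝ, ((a ⬝ᵥ v) ^ 2 - c) ^ 2 * ((b₁ ⬝ᵥ v) * (b₂ ⬝ᵥ v) * (b₃ ⬝ᵥ v)) ^ 2 *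
          Real.exp (-(β * (v ⬝ᵥ P *ᵥ v))) ≤
      (3 : ℝ) ^ (2 + 3) * (∫ v : ι → ℝ, ((a ⬝ᵥ v) ^ 2 - c) ^ 2 * Real.exp (-(β * (v ⬝ᵥ P *ᵥ v)))) *
        ∫ v : ι → ℝ, ((b₁ ⬝ᵥ v) * (b₂ ⬝ᵥ v) * (b₃ ⬝ᵥ v)) ^ 2 * Real.exp (-(β * (v ⬝ᵥ P *ᵥ v))) := by
  refine integral_sq_mul_sq_mul_exp_quadForm_le_of_polyDeg P hP hβ
    (F := fun v => (a ⬝ᵥ v) ^ 2 - c) (G := fun v => (b₁ ⬝ᵥ v) * (b₂ ⬝ᵥ v) * (b₃ ⬝ᵥ v)) ?_ ?_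
  · -- `(a·v)² − c`: degree ≤ 2
    have h1 : ∃ Q : MvPolynomial ι ℝ, Q.totalDegree ≤ 2 * 1 ∧ ∀ v : ι → ℝ, (a ⬝ᵥ v) ^ 2 = MvPolynomial.eval v Q :=
      polyDeg_pow (polyDeg_dotProduct a le_rfl) 2
    exact polyDeg_sub (polyDeg_mono (by norm_num) h1) (polyDeg_const c 2)
  · -- `(b₁·v)(b₂·v)(b₃·v)`: degree ≤ 3
    have h12 : ∃ Q : MvPolynomial ι ℝ, Q.totalDegree ≤ 1 + 1 ∧ ∀ v : ι → ℝ, (b₁ ⬝ᵥ v) * (b₂ ⬝ᵥ v) = MvPolynomial.eval v Q :=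
      polyDeg_mul (polyDeg_dotProduct b₁ le_rfl) (polyDeg_dotProduct b₂ le_rfl)
    exact polyDeg_mono (by norm_num) (polyDeg_mul h12 (polyDeg_dotProduct b₃ (le_refl 1)))

end Example

end Hypercontractivity

end Summit.QuantumFields.YangMills.Theorems.AllWindowsColdBoxBoxHighLine

end
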